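import Summits.QuantumFields.YangMills.Theorems.BalabanUVNodesPortHDecayOfRows

/-!
# PORT PT-H (slot 8) — THE DECAY ROAD IN TRACE FORM (director-ym №481 Q-11 (W2)): no colour-scalar row; `pvolOf` IS the normalised colour trace
# `(card ι)⁻¹ Σ_a Π^{aa}_{01}(z, 0)` by definition (`Node00.polWindow ∕ polScalar`), so with a COLOUR-INDEXED response link + gauge decay the (5.10) bound is the
# average of `card ι` identical per-colour bounds — bookkeeping, no isotropy content

Cell `ym-nodeO-ideate` ∕ `ym-balaban-port`, porter seat `ymgap-nodeO-port-PTC-1` (gen 2, slot-8 closer-designate).  Companion of `BalabanUVNodesPortHDecayOfRows` (the a★-form over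
the SIGNED T-3′ rows); this file is the (W2) variant the director prefers IF the text is re-typed with per-colour responses (PT-B's 27931 already quantifies `∀ a : θ.ιβ`).
★ `polComp_diag_eq_sum_re_mixedDeriv` — (4.37) per volume and per colour `a`: `Π^{aa}_{01}(z,0) = Σ_X Re ∂²(𝐄ₙ(X)∘χ_X)[hₙᵃ(X, e 1 0), hₙᵃ(X, e 0 z)]` from the representation, (4.14), the
colour-indexed response link `Gc n a (R.e n μ z) = Dιe(0)(δ_{μ,z}·bV a)` and the (1.7) cut; ★★ `decay510_plimOf_of_rows_trace` — `FormatPlusG` → `Chart44D` → Ward rows + (A3) →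
per-colour gauge decay `gauge (D n X) (cutTo (R.cX n X) (Gc n a y)) ≤ C₉e^{−δ₀dist}` → leaves + window isometry → colour-indexed RowL → `Limit121` ⟹
`Decay510 (plimOf F fam ρ bV k v 0 1) (16·E₀·C₉²·e^{δ₁Mg c₁}·K₀·K₁) (delta1 δ₀ κ Mg)`.
HONEST FRAMING.  Conditional over NAMED row predicates (all hypotheses); nothing of Bałaban discharged; the (W2) text is NOT yet cut or signed (Q-11 pending) — this is readiness, not a
close; finite `𝕋⁴_{L^K}` at fixed ε — NOT continuum ∕ OS ∕ Clay; **the Yang–Mills mass gap is NOT proved.**  No `def`, `instance`, `sorry`; standard axioms.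
-/

noncomputable section

open Filter Topology
open scoped BigOperators

namespace Summit.QuantumFields.YangMills.Theorems.PortH

open Literature.MathematicalPhysics.QuantumFieldTheory.Balaban1983to89
open Literature.MathematicalPhysics.QuantumFieldTheory.Balaban1983to89.Node00 (TermFamily1 siteOfInt polWindow polScalar)
open Literature.MathematicalPhysics.QuantumFieldTheory.Balaban1983to89.T4Continuum (T4Family)
open Literature.MathematicalPhysics.QuantumFieldTheory.Balaban1983to89.B12FormatPlus
open Literature.MathematicalPhysics.QuantumFieldTheory.Balaban1983to89.B12Decay510 (GeomLeaf CubeSumLeaf TreeLeaf delta1 mixedDeriv decay510_of_tendsto)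
open Literature.MathematicalPhysics.QuantumFieldTheory.Balaban1983to89.B12Decay510Gauge (abs_twoPoint_le_of_gauge)
open Literature.MathematicalPhysics.QuantumFieldTheory.Balaban1983to89.B12Eq435SecondVariation (ofReal_fderiv_fderiv_eq_sum_mixedDeriv_of_repr)
open Literature.MathematicalPhysics.QuantumFieldTheory.Balaban1983to89.Beta.RemainderLocality (mixedDeriv_comp_clm)
open Summit.QuantumFields.YangMills.Theorems.K0RecordFormatNames (ΦfOf pvolOf plimOf)
open Summit.QuantumFields.YangMills.Theorems.BalabanUVNodesPortS1 (ward414_of_gaugeInv119_chart44D)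

variable (F : T4Family) {𝔄 : Type} [NormedRing 𝔄] [NormedAlgebra ℝ 𝔄] {V : Type} [NormedAddCommGroup V] [NormedSpace ℝ V] {ι : Type} [Fintype ι]
  (fam : TermFamily1 F 𝔄) (ρ : V →L[ℝ] 𝔄) (bV : Module.Basis ι ℝ V) (k : ℕ) (v : Fin (k + 1) → ℝ)
  {S : ℕ → LocDomainSys} {M m : ℕ → ℕ}

/-- `pvolOf` IS the normalised colour trace of the diagonal components (definitional: `Node00.polWindow` ∕ `polScalar`). [cite: Balaban1987RG1, (1.20)–(1.21) p.264 («proportional to δ^{ab}» read as the trace)] -/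
theorem pvolOf_eq_trace (K : ℕ) (μ ν : Fin 4) (z : Fin 4 → ℤ) [DecidableEq ι] :
    pvolOf F fam ρ bV k v K μ ν z = (Fintype.card ι : ℝ)⁻¹ * ∑ a : ι,
      B12PolarizationTensor120.polComp ℝ (B12PolarizationTensor120.expChart (fam k v K) ρ) bV (Fin.cast (F.P_d K).symm μ) (siteOfInt F K (k + 1) z) a
        (Fin.cast (F.P_d K).symm ν) (siteOfInt F K (k + 1) 0) a := by
  classical
  unfold pvolOf polWindow polScalar
  congr 1

omit [Fintype ι] in
/-- ★ **(4.37) PER VOLUME AND PER COLOUR**: under the (1.19)-mould's pieces for `ΦfOf F fam ρ k v (K n)`, the chart on a (4.4)-domain, (4.14), the (A3)∕(1.7) cut and a COLOUR-INDEXED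
response link, the diagonal component `Π^{aa}_{01}(z, 0)` of (1.20) IS `Σ_X Re ∂²(𝐄ₙ(X)∘χ_X)[cutTo cX (Gc n a (e 1 0)), cutTo cX (Gc n a (e 0 z))]`.
[cite: Balaban1987RG1, (4.35) p.290, (4.37) p.291, (1.20) p.264, (1.7) p.261] -/
theorem polComp_diag_eq_sum_re_mixedDeriv (Uc : (n : ℕ) → (S n).Dom → Set (Fin (M n) → ℂ)) (coords : (n : ℕ) → (S n).Dom → Finset (Fin (M n)))
    (χ : (n : ℕ) → (S n).Dom → (Fin (m n) → ℂ) → (Fin (M n) → ℂ)) (D : (n : ℕ) → (S n).Dom → Set (Fin (m n) → ℂ))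
    (E : Pieces S M) (R : Response9Data S M m 4) (K : ℕ → ℕ) (Gc : (n : ℕ) → ι → R.Λ n → (Fin (m n) → ℂ))
    (ιe : (n : ℕ) → (Fin (F.P (K n)).d → Site (F.P (K n)) (k + 1) → V) → (Fin (m n) → ℂ))
    (hAn : Analytic19 Uc E) (hLoc : Local17 coords E) (hRep : Repr17 S E χ (fun n => ΦfOf F fam ρ k v (K n)) ιe) (hW : Ward414 χ E)
    (hC : Chart44D S M Uc m χ D) (hcut : ∀ n X u, ∀ i ∈ coords n X, χ n X (cutTo (R.cX n X) u) i = χ n X u i)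
    (hL : ∀ n, ιe n 0 = 0 ∧ ContDiffAt ℝ 2 (ιe n) 0 ∧ ∀ (a : ι) (μ : Fin 4) (z : Fin 4 → ℤ),
      Gc n a (R.e n μ z) = fderiv ℝ (ιe n) 0 (Pi.single (Fin.cast (F.P_d (K n)).symm μ) (Pi.single (siteOfInt F (K n) (k + 1) z) (bV a))))
    (n : ℕ) (a : ι) (z : Fin 4 → ℤ) :
    B12PolarizationTensor120.polComp ℝ (B12PolarizationTensor120.expChart (fam k v (K n)) ρ) bV (Fin.cast (F.P_d (K n)).symm 0) (siteOfInt F (K n) (k + 1) z) a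
        (Fin.cast (F.P_d (K n)).symm 1) (siteOfInt F (K n) (k + 1) 0) a =
      ∑ X, (mixedDeriv (fun u => E n X (χ n X u)) (cutTo (R.cX n X) (Gc n a (R.e n 1 0))) (cutTo (R.cX n X) (Gc n a (R.e n 0 z)))).re := by
  classical
  obtain ⟨hι0, hιC2, hGk⟩ := hL n
  have hF : ∀ X, AnalyticAt ℂ (fun u => E n X (χ n X u)) 0 := fun X => by
    obtain ⟨-, -, -, h0, hχan, hmaps⟩ := hC n X
    exact (hAn n X (χ n X 0) (hmaps h0)).comp (hχan 0 h0)
  have hrepr : (fun B => ((B12PolarizationTensor120.expChart (fam k v (K n)) ρ B : ℝ) : ℂ)) =ᶠ[𝓝 0]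
      fun B => ∑ X, (fun u => E n X (χ n X u)) (ιe n B) := hRep n
  set p : Fin (F.P (K n)).d → Site (F.P (K n)) (k + 1) → V := Pi.single (Fin.cast (F.P_d (K n)).symm 0) (Pi.single (siteOfInt F (K n) (k + 1) z) (bV a)) with hp
  set q : Fin (F.P (K n)).d → Site (F.P (K n)) (k + 1) → V := Pi.single (Fin.cast (F.P_d (K n)).symm 1) (Pi.single (siteOfInt F (K n) (k + 1) 0) (bV a)) with hq
  have hbridge := (ofReal_fderiv_fderiv_eq_sum_mixedDeriv_of_repr (fun X u => E n X (χ n X u)) (ιe n) _ hrepr hι0 hιC2 hF (hW n) p q).2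
  -- `polComp` is that second derivative (definition of `polComp ∕ polTensor`)
  have hpc : ((B12PolarizationTensor120.polComp ℝ (B12PolarizationTensor120.expChart (fam k v (K n)) ρ) bV (Fin.cast (F.P_d (K n)).symm 0)
      (siteOfInt F (K n) (k + 1) z) a (Fin.cast (F.P_d (K n)).symm 1) (siteOfInt F (K n) (k + 1) 0) a : ℝ) : ℂ) =
      ∑ X, mixedDeriv (fun u => E n X (χ n X u)) (fderiv ℝ (ιe n) 0 q) (fderiv ℝ (ιe n) 0 p) := hbridge
  rw [← hGk a 1 0, ← hGk a 0 z] at hpc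
  have hcutEq : ∀ X (a' b' : Fin (m n) → ℂ), mixedDeriv (fun u => E n X (χ n X u)) a' b' =
      mixedDeriv (fun u => E n X (χ n X u)) (cutTo (R.cX n X) a') (cutTo (R.cX n X) b') := by
    intro X a' b'
    obtain ⟨T, hT⟩ := exists_cutTo_clm (R.cX n X)
    have hfun : (fun u => E n X (χ n X u)) = fun u => (fun u => E n X (χ n X u)) (T u) := by
      funext u; rw [hT]; exact (hLoc n X _ _ fun i hi => (hcut n X u i hi)).symm
    obtain ⟨r, hr, hball⟩ : ∃ r > 0, ∀ y ∈ Metric.ball (0 : Fin (m n) → ℂ) r, DifferentiableAt ℂ (fun u => E n X (χ n X u)) y := by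
      obtain ⟨s, hs, hsub⟩ := Metric.mem_nhds_iff.1 (hF X).eventually_analyticAt
      exact ⟨s, hs, fun y hy => (hsub hy).differentiableAt⟩
    conv_lhs => rw [hfun]
    rw [mixedDeriv_comp_clm hr hball T a' b', hT, hT]
  rw [Finset.sum_congr rfl fun X _ => hcutEq X _ _] at hpc
  have := congrArg Complex.re hpc
  rw [Complex.ofReal_re, Complex.re_sum] at this
  exact this

omit [Fintype ι] in
/-- ★ **THE PER-COLOUR CORE at one volume** (CRIT-1 Q-11 (W2a): «the Cauchy∕(5.10) bound for the (a,a) component from the rows AT COLOUR a»): for pieces `E` with (1.9) analyticity,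
(1.18), (1.7) locality, the representation of `ΦfOf F fam ρ k v (K n)` and (4.14), the chart on a (4.4)-domain with the (A3) cut, the gauge decay of the cut responses OF COLOUR `a`, the three
leaves at volume `n` and the colour-`a` response link: `|Π^{aa}_{01}(z, 0)| ≤ 16·E₀·C₉²·e^{δ₁Mg c₁}·K₀·K₁·e^{−δ₁ρₙ(e 1 0, e 0 z)}`, `δ₁ = ½ min{δ₀, κ∕Mg}`.
[cite: Balaban1987RG1, (5.10) p.293, (4.35)–(4.37) pp.290–291, (4.4)–(4.5) pp.281–282; Balaban1985Variational, Prop. 9 p.309] -/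
theorem abs_polComp_diag_le_of_rows (Uc : (n : ℕ) → (S n).Dom → Set (Fin (M n) → ℂ)) (coords : (n : ℕ) → (S n).Dom → Finset (Fin (M n)))
    (χ : (n : ℕ) → (S n).Dom → (Fin (m n) → ℂ) → (Fin (M n) → ℂ)) (D : (n : ℕ) → (S n).Dom → Set (Fin (m n) → ℂ))
    (E : Pieces S M) (R : Response9Data S M m 4) (K : ℕ → ℕ) (Gc : (n : ℕ) → ι → R.Λ n → (Fin (m n) → ℂ))
    (ιe : (n : ℕ) → (Fin (F.P (K n)).d → Site (F.P (K n)) (k + 1) → V) → (Fin (m n) → ℂ))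
    {E₀ κ C₉ δ₀ Mg c₁ K₀ K₁ : ℝ} (hE₀ : 0 ≤ E₀) (hκ : 0 ≤ κ) (hC₉ : 0 ≤ C₉) (hδ₀ : 0 ≤ δ₀) (hMg : 0 < Mg) (hK₀ : 0 ≤ K₀)
    (hAn : Analytic19 Uc E) (hB : Bound118 S Uc E E₀ κ) (hLoc : Local17 coords E) (hRep : Repr17 S E χ (fun n => ΦfOf F fam ρ k v (K n)) ιe)
    (hW : Ward414 χ E) (hC : Chart44D S M Uc m χ D) (hcut : ∀ n X u, ∀ i ∈ coords n X, χ n X (cutTo (R.cX n X) u) i = χ n X u i)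
    (n : ℕ) (a : ι)
    (hdec : ∀ X y, gauge (D n X) (cutTo (R.cX n X) (Gc n a y)) ≤ C₉ * Real.exp (-δ₀ * (R.G n).distD y X))
    (hgeo : GeomLeaf (R.G n) (R.ρ n) Mg c₁) (hcube : CubeSumLeaf (R.G n) (δ₀ / 2) K₁) (htree : TreeLeaf (R.Cc n) (κ / 2) K₀)
    (hL : ∀ n, ιe n 0 = 0 ∧ ContDiffAt ℝ 2 (ιe n) 0 ∧ ∀ (a : ι) (μ : Fin 4) (z : Fin 4 → ℤ),
      Gc n a (R.e n μ z) = fderiv ℝ (ιe n) 0 (Pi.single (Fin.cast (F.P_d (K n)).symm μ) (Pi.single (siteOfInt F (K n) (k + 1) z) (bV a))))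
    (z : Fin 4 → ℤ) :
    |B12PolarizationTensor120.polComp ℝ (B12PolarizationTensor120.expChart (fam k v (K n)) ρ) bV (Fin.cast (F.P_d (K n)).symm 0)
        (siteOfInt F (K n) (k + 1) z) a (Fin.cast (F.P_d (K n)).symm 1) (siteOfInt F (K n) (k + 1) 0) a| ≤
      16 * E₀ * C₉ ^ 2 * Real.exp (delta1 δ₀ κ Mg * Mg * c₁) * K₀ * K₁ * Real.exp (-(delta1 δ₀ κ Mg) * R.ρ n (R.e n 1 0) (R.e n 0 z)) := by
  rw [polComp_diag_eq_sum_re_mixedDeriv F fam ρ bV k v Uc coords χ D E R K Gc ιe hAn hLoc hRep hW hC hcut hL n a z]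
  have hD : ∀ X : (S n).Dom, Convex ℝ (D n X) ∧ Balanced ℂ (D n X) ∧ IsOpen (D n X) ∧ (0 : Fin (m n) → ℂ) ∈ D n X := fun X => by
    obtain ⟨h1, h2, h3, h4, -, -⟩ := hC n X; exact ⟨h1, h2, h3, h4⟩
  have han : ∀ X : (S n).Dom, AnalyticOnNhd ℂ (fun u => E n X (χ n X u)) (D n X) := fun X w hw => by
    obtain ⟨-, -, -, -, hχan, hmaps⟩ := hC n X
    exact (hAn n X (χ n X w) (hmaps hw)).comp (hχan w hw)
  have h118 : ∀ X : (S n).Dom, ∀ w ∈ D n X, ‖E n X (χ n X w)‖ ≤ E₀ * Real.exp (-κ * (S n).dj X) := fun X w hw => by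
    obtain ⟨-, -, -, -, -, hmaps⟩ := hC n X
    exact (bound118_iff Uc E E₀ κ).1 hB n X _ (hmaps hw)
  exact abs_twoPoint_le_of_gauge (R.G n) (ρ := R.ρ n) (fun X u => E n X (χ n X u)) (D n) (fun X y => cutTo (R.cX n X) (Gc n a y))
    (fun X x y => (mixedDeriv (fun u => E n X (χ n X u)) (cutTo (R.cX n X) (Gc n a x)) (cutTo (R.cX n X) (Gc n a y))).re)
    hE₀ hC₉ hK₀ hδ₀ hκ hMg hD han h118 (fun _ _ _ => rfl) (fun X y => hdec X y) hgeo hcube htree _ _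

/-- ★★ **THE DECAY ROAD IN TRACE FORM** (no colour-scalar row): (1.19)-mould at one real history ∧ `Chart44D` ∧ Ward rows ∧ (A3) ∧ PER-COLOUR gauge decay of the cut responses ∧ leaves ∧ window
isometry ∧ colour-indexed response link ∧ (1.21) ⟹ `Decay510 (plimOf F fam ρ bV k v 0 1) (16·E₀·C₉²·e^{δ₁Mg c₁}·K₀·K₁) δ₁` — the average of `card ι` identical per-colour (5.10) bounds.
[cite: Balaban1987RG1, (5.10) p.293, (4.35)–(4.37) pp.290–291, (1.18)–(1.21) pp.263–264, (4.4)–(4.5) pp.281–282, (4.14) p.284; Balaban1985Variational, Prop. 9 p.309] -/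
theorem decay510_plimOf_of_rows_trace [DecidableEq ι] (Uc : (n : ℕ) → (S n).Dom → Set (Fin (M n) → ℂ)) (coords : (n : ℕ) → (S n).Dom → Finset (Fin (M n)))
    (χ : (n : ℕ) → (S n).Dom → (Fin (m n) → ℂ) → (Fin (M n) → ℂ)) (D : (n : ℕ) → (S n).Dom → Set (Fin (m n) → ℂ))
    {Gg : ℕ → Type*} (act : (n : ℕ) → Gg n → (Fin (M n) → ℂ) → (Fin (M n) → ℂ)) {Hg : ℕ → Type*} (toG : (n : ℕ) → Hg n → Gg n)
    (A : (n : ℕ) → Hg n → ((Fin (m n) → ℂ) →L[ℂ] (Fin (m n) → ℂ))) (R : Response9Data S M m 4) (K : ℕ → ℕ)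
    (Gc : (n : ℕ) → ι → R.Λ n → (Fin (m n) → ℂ))
    (ιe : (n : ℕ) → (Fin (F.P (K n)).d → Site (F.P (K n)) (k + 1) → V) → (Fin (m n) → ℂ))
    {E₀ κ C₉ δ₀ Mg c₁ K₀ K₁ : ℝ} (hE₀ : 0 ≤ E₀) (hκ : 0 ≤ κ) (hC₉ : 0 ≤ C₉) (hδ₀ : 0 ≤ δ₀) (hMg : 0 < Mg) (hK₀ : 0 ≤ K₀)
    (hA : FormatPlusG S M act Uc coords m χ (fun n => ΦfOf F fam ρ k v (K n)) ιe R.wrap R.emb R.πc E₀ κ)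
    (hC : Chart44D S M Uc m χ D) (hEq : ChartEquivariant toG act χ A) (hN : ∀ n, NoInvariantCovector (A n))
    (hcut : ∀ n X u, ∀ i ∈ coords n X, χ n X (cutTo (R.cX n X) u) i = χ n X u i)
    (hdec : ∀ n (a : ι) X y, gauge (D n X) (cutTo (R.cX n X) (Gc n a y)) ≤ C₉ * Real.exp (-δ₀ * (R.G n).distD y X))
    (hgeo : ∀ n, GeomLeaf (R.G n) (R.ρ n) Mg c₁) (hcube : ∀ n, CubeSumLeaf (R.G n) (δ₀ / 2) K₁) (htree : ∀ n, TreeLeaf (R.Cc n) (κ / 2) K₀)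
    (hρ : ∀ (μ ν : Fin 4) (z : Fin 4 → ℤ), ∀ᶠ n in atTop, R.ρ n (R.e n μ 0) (R.e n ν z) = B12Sec2to5.l1 z)
    (hL : ∀ n, ιe n 0 = 0 ∧ ContDiffAt ℝ 2 (ιe n) 0 ∧ ∀ (a : ι) (μ : Fin 4) (z : Fin 4 → ℤ),
      Gc n a (R.e n μ z) = fderiv ℝ (ιe n) 0 (Pi.single (Fin.cast (F.P_d (K n)).symm μ) (Pi.single (siteOfInt F (K n) (k + 1) z) (bV a))))
    (hLim : Limit121 (fun n => pvolOf F fam ρ bV k v (K n)) (plimOf F fam ρ bV k v)) :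
    B12Sec2to5.Decay510 (plimOf F fam ρ bV k v 0 1) (16 * E₀ * C₉ ^ 2 * Real.exp (delta1 δ₀ κ Mg * Mg * c₁) * K₀ * K₁) (delta1 δ₀ κ Mg) := by
  obtain ⟨E, hAn, hB, hLoc, hRep, -, hG⟩ := hA
  have hW : Ward414 χ E := ward414_of_gaugeInv119_chart44D hG hEq hC hAn hN
  refine decay510_of_tendsto (fun n z => pvolOf F fam ρ bV k v (K n) 0 1 z) (fun z => hLim 0 1 z) fun z => ?_
  filter_upwards [hρ 1 0 z] with n hn
  -- per colour, the (5.10) bound at this volume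
  have hcol : ∀ a : ι, |B12PolarizationTensor120.polComp ℝ (B12PolarizationTensor120.expChart (fam k v (K n)) ρ) bV (Fin.cast (F.P_d (K n)).symm 0)
      (siteOfInt F (K n) (k + 1) z) a (Fin.cast (F.P_d (K n)).symm 1) (siteOfInt F (K n) (k + 1) 0) a| ≤
      16 * E₀ * C₉ ^ 2 * Real.exp (delta1 δ₀ κ Mg * Mg * c₁) * K₀ * K₁ * Real.exp (-(delta1 δ₀ κ Mg) * B12Sec2to5.l1 z) := by
    intro a
    rw [← hn]
    exact abs_polComp_diag_le_of_rows F fam ρ bV k v Uc coords χ D E R K Gc ιe hE₀ hκ hC₉ hδ₀ hMg hK₀ hAn hB hLoc hRep hW hC hcut n a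
      (hdec n a) (hgeo n) (hcube n) (htree n) hL z
  -- average over the colours
  rw [pvolOf_eq_trace]
  set Cz : ℝ := 16 * E₀ * C₉ ^ 2 * Real.exp (delta1 δ₀ κ Mg * Mg * c₁) * K₀ * K₁ * Real.exp (-(delta1 δ₀ κ Mg) * B12Sec2to5.l1 z) with hCz
  have hsum : |∑ a : ι, B12PolarizationTensor120.polComp ℝ (B12PolarizationTensor120.expChart (fam k v (K n)) ρ) bV (Fin.cast (F.P_d (K n)).symm 0)
      (siteOfInt F (K n) (k + 1) z) a (Fin.cast (F.P_d (K n)).symm 1) (siteOfInt F (K n) (k + 1) 0) a| ≤ (Fintype.card ι : ℝ) * Cz :=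
    (Finset.abs_sum_le_sum_abs _ _).trans <| by
      calc ∑ a : ι, |B12PolarizationTensor120.polComp ℝ (B12PolarizationTensor120.expChart (fam k v (K n)) ρ) bV (Fin.cast (F.P_d (K n)).symm 0)
              (siteOfInt F (K n) (k + 1) z) a (Fin.cast (F.P_d (K n)).symm 1) (siteOfInt F (K n) (k + 1) 0) a|
          ≤ ∑ _a : ι, Cz := Finset.sum_le_sum fun a _ => hcol a
        _ = (Fintype.card ι : ℝ) * Cz := by rw [Finset.sum_const, Finset.card_univ, nsmul_eq_mul]
  rw [abs_mul, abs_inv, Nat.abs_cast]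
  -- `0 ≤ K₁` is forced by the cube-sum leaf at any label (a sum of exponentials is nonnegative)
  have hK₁ : 0 ≤ K₁ := (Finset.sum_nonneg fun c _ => (Real.exp_pos _).le).trans (hcube n (R.e n 1 0))
  have hCz0 : 0 ≤ Cz := by
    rw [hCz]
    exact mul_nonneg (mul_nonneg (mul_nonneg (mul_nonneg (mul_nonneg (mul_nonneg (by norm_num) hE₀) (sq_nonneg _)) (Real.exp_pos _).le) hK₀) hK₁)
      (Real.exp_pos _).le
  rcases Nat.eq_zero_or_pos (Fintype.card ι) with h0 | hpos
  · rw [h0, Nat.cast_zero, inv_zero, zero_mul]; exact hCz0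
  · have hcard : (0 : ℝ) < Fintype.card ι := Nat.cast_pos.2 hpos
    calc (Fintype.card ι : ℝ)⁻¹ * |∑ a : ι, _| ≤ (Fintype.card ι : ℝ)⁻¹ * ((Fintype.card ι : ℝ) * Cz) :=
          mul_le_mul_of_nonneg_left hsum (inv_nonneg.2 hcard.le)
      _ = Cz := by field_simp

end Summit.QuantumFields.YangMills.Theorems.PortH

end
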